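import Summits.CriticalPhenomena.PercolationContinuityZ3.Theorems.PercNearOneGluingNoHeavyQuantSliceSingleLayerReduction
import HarnessLib

/-!
# QUANT lane R8, T-DEC: LEMMA D IS A THEOREM (deep pairs at their minimal gate are sliceable — BLOB-DEC(2) + `LightTwoBlobDEC`), and LEMMA W
# is implied by ONE law-level statement `LawDec.SliceLawSW` about explicit 5-atom laws; hence
# `SliceLawSW → SliceSingleLayer → SliceDominated → SliceClosedAll`, `→ SliceClosedWindowT`

builds on p205010 (kernel theorem, internal audit signed; external expert review pending)

Statement + support file (`--supports stmt-CriticalPhenomena-4575`), QUANT lane seat prim-quant-census-2 (gen 55), rung R8 of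
`run/shared/lean/prim/quant/LADDER.md`.  Memo `run/shared/lean/prim/quant/prim-quant-census-2-g55/SINGLE-LAYER-G55.md` §3–§3b.  One small
definition (`LawDec.swLaw`), one `@[conjecture]` (`LawDec.SliceLawSW`), theorems with standard axioms, no sorries.  Continues this seat's
`…QuantSliceSingleLayer` (p309331) and `…QuantSliceSingleLayerReduction` (p310459: `SliceMidLemmaD`, `SliceMidLemmaW`, `sliceSingleLayer_of_midLemmas`).

THE OBSERVATION (memo §3b).  The mid condition `Φ(l) ≤ usage(l,h)·(−Φ(h))` of a certificate `e` IS weak duality of `e` against the slice of the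
two-point component `c = {l, h; γ}`, `γ = pairGate x T l h` (minimal gate, credit exactly `T`): `⟨e, slice c⟩ = (1−γ)Φ(l) + γΦ(h)`
(`sum_pullback_TP`).  Hence:
* **LEMMA D is a theorem** (`sliceMidLemmaD_holds : SliceMidLemmaD`): for `h + a ≤ j′` the slice of `{l,h;γ}` is DEC at `(T + ag, j′)` —
  `slice_minGatePair_decAtT`: heavy gate `γ ≥ x` by `slice_heavyPair_decAtT` (census-2 g51's BLOB-DEC(2)), light gate `x² < γ < x` by
  `slice_lightBelow_decAtT` + `lightTwoBlobDEC_holds` (typer g22/g23) — and `dual_le_of_decAtT` gives the inequality for EVERY certificate.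
* **LEMMA W ⟸ `SliceLawSW`** (`sliceMidLemmaW_of_lawSW`): for a WINDOW pair (`j′ < h + a`) the slice of `{l,h;γ}` need not be DEC, but LEMMA W only
  concerns certificates for which some window position `h′ ≥ h` is CHEAP (combined price below the cheapest giant `q₀`).  If the TRANSFERRED law
  `swLaw γ g t l h h′ a = (1−γ)[(1−g)δ_l + gδ_{l+a}] + γ(1−g)δ_h + t(1−g)δ_{h′} + (γg − t(1−g))δ_{h+a}` (move `t(1−g) ≤ γg` of the row-1 giant mass of
  the pair down to the row-0 copy of `h′`) is DEC for some `t ≥ 0`, then weak duality gives `(1−γ)Φ(l) + γΦ(h) + t(1−g)(e(h′) − e(h+a)) ≤ 0`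
  (`sum_coef_swLaw`), and cheapness gives `e(h′) − e(h+a) > 0` (`β(h+a), β(h′+a) ≥ β q₀ > −Φ(h′)`), so the mid condition follows.  `g = 1` makes
  cheapness impossible.  EVIDENCE for `SliceLawSW` (exact LP with `t` as a variable, code/swtest.py, swt2.py; `g < 1`): 0 failures on 122 277 + 226 000
  configurations; `t = 0` suffices for every heavy pair (`slice_heavyPair_decAtT` needs only `h ≤ j′`) and for all but 17 shallow-low cases; `t = t_max`
  (no giant left) or `t = 0` covers 87 % of the deep light cases, the remaining 13 416 / 100 k need an interior `t` (the feasible `t`-set is an interval).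
  PROOF PLAN (memo §3c): the case `h′ > h` follows from `h′ = h` (moving mid mass to a higher mid `≤ j′` preserves DEC: re-label the `hi` of pairs, credits grow);
  for `h′ = h`, deep `l`, light `γ`: the explicit transfer `t*` (position `h` absorbs exactly the row-1 low through the anti-diagonal, plus the row-0 low when
  its `T′`-pair is light) decides like the LP on 71 711 / 71 711 instances and reduces DEC to the two inequalities (I-A) `(1−g)·x/(1−x) + g·U(ρ_ad) ≤ U(ρ⁰)`
  (row-0 pair heavy or dead at `T′`) and (I-B) `g·U(ρ_ad) + (1−g)·U(ρ′) ≤ U(ρ⁰)` (row-0 pair light), `U(ρ) = γ(ρ)/(1−γ(ρ))`; on the light branch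
  `U(ρ) + 1 = 1/((1−x)(1+x−ρ))` and both follow by short algebra using exactly `x ≤ g` (memo §3c, exact checks code/algcheck.py, swineq.py).
So the slice-closure programme of the T-DEC law level (SliceClosedAll ⟹ BLOB-DEC(k) ∀ k; the window form of record) now rests on the single explicit
law-level conjecture `SliceLawSW` — a statement of the same kind as `LightTwoBlobDEC` (5 atoms, one free transfer parameter).

* `LawDec.sum_mul_indicator`, `sum_pullback_TP`, `sum_coef_swLaw` — bookkeeping.
* **`LawDec.slice_minGatePair_decAtT`**, **`sliceMidLemmaD_holds : SliceMidLemmaD`**.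
* `LawDec.swLaw`, **`LawDec.SliceLawSW`** (`@[conjecture]`), **`sliceMidLemmaW_of_lawSW : SliceLawSW → SliceMidLemmaW`**.
* **`sliceSingleLayer_of_lawSW`**, **`sliceClosedAll_of_lawSW`**, **`sliceClosedWindowT_of_lawSW`**.
HONEST: `SliceLawSW`, `SliceMidLemmaW`, `SliceSingleLayer`, `SliceDominated`, `SliceClosedAll`, `SliceClosedWindowT`, `ConvClosedT`, BLOB-DEC(k ≥ 3), `TreeBuiltDEC`,
`SDECConvClosed`, `Quant.TreeDEC`, `FarTreeRow` remain OPEN; `SliceMidLemmaD` is now PROVED; `SliceClosed`/`SliceClosedT` are FALSE.  Rate / honest sentence unchanged.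

[this work]; memos SINGLE-LAYER-G55, SL-STRUCTURE-G54 (this lane).  The gluing rows served [cite: KozmaNitzan2024, Conjecture 3 (p. 15)]; product measure
[cite: Grimmett1999, §1.3 p. 10].
-/

noncomputable section

namespace Summit.CriticalPhenomena.PercolationContinuityZ3.Theorems

namespace Quant

open Finset

/-- the two-point law `{lo, hi; g}` (as in `…QuantLawDEC`) -/
local notation3 "TP[" lo ", " hi ", " g ", " h "]" =>
  (g : ℝ) * (if (h : ℕ) = (hi : ℕ) then (1 : ℝ) else 0) + (1 - (g : ℝ)) * (if (h : ℕ) = (lo : ℕ) then (1 : ℝ) else 0)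

namespace LawDec

/-! ### Bookkeeping: sums against indicators -/

/-- `Σ_{p ≤ N} F p · [p = k] = F k` for `k ≤ N`. [folklore] -/
theorem sum_mul_indicator (F : ℕ → ℝ) (N k : ℕ) (hk : k ≤ N) :
    ∑ p ∈ Finset.range (N + 1), F p * (if p = k then (1 : ℝ) else 0) = F k := by
  have e : ∀ p ∈ Finset.range (N + 1), F p * (if p = k then (1 : ℝ) else 0) = if p = k then F p else 0 := by
    intro p _
    split_ifs <;> simp
  rw [Finset.sum_congr rfl e, Finset.sum_ite_eq']
  rw [if_pos (Finset.mem_range.2 (by omega))]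

/-! ### SD: deep pairs at their minimal gate are sliceable (from BLOB-DEC(2) and `LightTwoBlobDEC`) -/

/-- **the slice of a minimal-gate credit pair below the window is DEC.**  For `0 < x < 1`, `x ≤ g ≤ 1`, `1 ≤ a`, a low `l` (`2l < T`) and a
`T`-compatible absorber `h` (`T < l + h`) with `h + a ≤ j′`, `h ≤ M`: the slice of `{l, h; pairGate x T l h}` is DEC(j′) at target `T + a·g` on
`{0..M+a}` — heavy gate: `slice_heavyPair_decAtT` (BLOB-DEC(2)); light gate: `slice_lightBelow_decAtT` + `lightTwoBlobDEC_holds` (typer g23).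
The credit of the pair at its minimal gate is exactly `T`. [this work] -/
theorem slice_minGatePair_decAtT (x T g : ℝ) (j' M l h a : ℕ) (hx0 : 0 < x) (hx1 : x < 1) (hxg : x ≤ g) (hg1 : g ≤ 1) (ha : 1 ≤ a)
    (hlow : 2 * (l : ℝ) < T) (hcomp : T < (l : ℝ) + h) (hha : h + a ≤ j') (hhM : h ≤ M) :
    DECAtT x (T + (a : ℝ) * g) j' (M + a) (slice (fun t => TP[l, h, pairGate x T l h, t]) a g) := by
  have hlh' : (l : ℝ) < h := by linarith
  have hlh : l < h := by exact_mod_cast hlh'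
  have hd : (0 : ℝ) < (h : ℝ) - l := by linarith
  have hγ0 : 0 < pairGate x T l h := pairGate_pos x T l h hlow hlh
  have hγ1 : pairGate x T l h < 1 := pairGate_lt_one x T l h hx0 hx1 hlow hcomp
  -- the credit at the minimal gate is at least T
  have hρ : (T - 2 * (l : ℝ)) / ((h : ℝ) - l) ≤ pairGate x T l h := le_max_left _ _
  have hlam : x ^ 2 + (1 - x) * ((T - 2 * (l : ℝ)) / ((h : ℝ) - l)) ≤ pairGate x T l h := le_max_right _ _
  have hcredH : T ≤ 2 * (l : ℝ) + ((h : ℝ) - l) * pairGate x T l h := by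
    have := mul_le_mul_of_nonneg_left hρ hd.le
    rw [mul_div_cancel₀ _ hd.ne'] at this
    linarith
  by_cases hxγ : x ≤ pairGate x T l h
  · exact slice_heavyPair_decAtT x (T + (a : ℝ) * g) g (pairGate x T l h) j' M l h a hx0 hx1 hxg hg1 hxγ hγ1.le ha hlh
      (by omega) hhM (by linarith)
  · have hγx : pairGate x T l h < x := not_le.1 hxγ
    have hρpos : 0 < (T - 2 * (l : ℝ)) / ((h : ℝ) - l) := div_pos (by linarith) hd
    have hx2 : x ^ 2 < pairGate x T l h := by
      have h1x : 0 < 1 - x := by linarith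
      nlinarith [mul_pos h1x hρpos]
    have hcredL : T ≤ 2 * (l : ℝ) + ((h : ℝ) - l) * ((pairGate x T l h - x ^ 2) / (1 - x)) := by
      have h1x : 0 < 1 - x := by linarith
      have hr : (T - 2 * (l : ℝ)) / ((h : ℝ) - l) ≤ (pairGate x T l h - x ^ 2) / (1 - x) := by
        rw [le_div_iff₀ h1x]; linarith
      have := mul_le_mul_of_nonneg_left hr hd.le
      rw [mul_div_cancel₀ _ hd.ne'] at this
      linarith
    exact slice_lightBelow_decAtT lightTwoBlobDEC_holds x (T + (a : ℝ) * g) g (pairGate x T l h) j' M l h a hx0 hx1 hxg hg1 hx2 hγx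
      ha hlh hha hhM (by linarith)

/-- the pullback pairs with a two-point component: `Σ_{k ≤ M} Φ(k)·{l,h;γ}(k) = (1−γ)Φ(l) + γΦ(h)`. [this work] -/
theorem sum_pullback_TP (Φ : ℕ → ℝ) (M l h : ℕ) (γ : ℝ) (hl : l ≤ M) (hh : h ≤ M) :
    ∑ k ∈ Finset.range (M + 1), Φ k * TP[l, h, γ, k] = (1 - γ) * Φ l + γ * Φ h := by
  have e : ∀ k ∈ Finset.range (M + 1), Φ k * TP[l, h, γ, k]
      = γ * (Φ k * (if k = h then (1 : ℝ) else 0)) + (1 - γ) * (Φ k * (if k = l then (1 : ℝ) else 0)) := by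
    intro k _; ring
  rw [Finset.sum_congr rfl e, Finset.sum_add_distrib, ← Finset.mul_sum, ← Finset.mul_sum,
    sum_mul_indicator Φ M h hh, sum_mul_indicator Φ M l hl]
  ring

/-- **LEMMA D HOLDS** (`SliceMidLemmaD`): weak duality of the certificate against the DEC slice of the minimal-gate pair `{l, h}`
(`slice_minGatePair_decAtT`) is exactly the mid condition `Φ(l) ≤ usage(l,h)·(−Φ(h))`. [this work] -/
theorem sliceMidLemmaD_holds : SliceMidLemmaD := by
  intro x g T M a j' α β hx0 hx1 hxg hg1 ha hjM hβ hαβ l h J hla hlow hhM hha hT2 hcomp hhJ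
  have hlh' : (l : ℝ) < h := by linarith
  have hlh : l < h := by exact_mod_cast hlh'
  set γ : ℝ := pairGate x T l h with hγ
  have hγ0 : 0 < γ := pairGate_pos x T l h hlow hlh
  have hγ1 : γ < 1 := pairGate_lt_one x T l h hx0 hx1 hlow hcomp
  set c : ℕ → ℝ := fun t => TP[l, h, γ, t] with hc
  have hdec : DECAtT x (T + (a : ℝ) * g) j' (M + a) (slice c a g) :=
    slice_minGatePair_decAtT x T g j' M l h a hx0 hx1 hxg hg1 ha hlow hcomp hha hhM
  have wd := dual_le_of_decAtT x (T + (a : ℝ) * g) j' (M + a) (slice c a g) hx0 hx1 hdec α β hβ hαβ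
  have e1 := dual_functional_eq (T + (a : ℝ) * g) j' (M + a) α β (slice c a g) hjM.le
  have hcM : ∀ t, M < t → c t = 0 := by
    intro t ht
    simp only [hc]
    rw [if_neg (by omega), if_neg (by omega)]; ring
  rw [slice_functional_eq c (coefAt (T + (a : ℝ) * g) j' α β) M a g hcM] at e1
  have e2 : ∑ k ∈ Finset.range (M + 1), ((1 - g) * coefAt (T + (a : ℝ) * g) j' α β k + g * coefAt (T + (a : ℝ) * g) j' α β (k + a)) * c k
      = (1 - γ) * slicePullback (T + (a : ℝ) * g) g j' a α β l + γ * slicePullback (T + (a : ℝ) * g) g j' a α β h := by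
    have := sum_pullback_TP (slicePullback (T + (a : ℝ) * g) g j' a α β) M l h γ (by omega) hhM
    simpa only [slicePullback, hc] using this
  rw [e2] at e1
  have hineq : (1 - γ) * slicePullback (T + (a : ℝ) * g) g j' a α β l + γ * slicePullback (T + (a : ℝ) * g) g j' a α β h ≤ 0 := by
    linarith
  have hu : usage x T J l h = γ / (1 - γ) := by
    have hnj : ¬ (J + 1 ≤ h) := by omega
    simp only [usage, gateOf, if_neg hnj, hγ]
  rw [hu]
  have h1γ : 0 < 1 - γ := by linarith
  rw [div_mul_eq_mul_div, le_div_iff₀ h1γ]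
  nlinarith

/-! ### SW: the law-level form of LEMMA W -/

/-- **the transferred slice law of a window pair** `{l, h; γ}` (`h` window): the slice with `t(1−g)` of its row-1 giant mass `γ·g` moved down to the
row-0 copy of a window position `h′`: `(1−γ)[(1−g)δ_l + gδ_{l+a}] + γ(1−g)δ_h + t(1−g)δ_{h′} + (γg − t(1−g))δ_{h+a}`. [this work] -/
def swLaw (γ g t : ℝ) (l h h' a : ℕ) : ℕ → ℝ := fun p =>
  (1 - γ) * (1 - g) * (if p = l then (1 : ℝ) else 0) + (1 - γ) * g * (if p = l + a then (1 : ℝ) else 0)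
    + γ * (1 - g) * (if p = h then (1 : ℝ) else 0) + t * (1 - g) * (if p = h' then (1 : ℝ) else 0)
    + (γ * g - t * (1 - g)) * (if p = h + a then (1 : ℝ) else 0)

/-- **CONJECTURE SW (law-level LEMMA W; census-2 g55, memo SINGLE-LAYER-G55 §3).**  For `0 < x < 1`, `x ≤ g < 1`, `1 ≤ a`, a low `l` (`l + a ≤ j′`,
`2l < T`), a WINDOW absorber `h` (`j′ < h + a`, `T ≤ 2h`, `T < l + h`) and any window position `h′` with `h ≤ h′ ≤ min(j′, M)`: for SOME transfer
`0 ≤ t(1−g) ≤ γ·g` (`γ = pairGate x T l h`) the transferred slice law `swLaw γ g t l h h′ a` is DEC(j′) at target `T + a·g` on `{0..M+a}`.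
EVIDENCE (exact LP with `t` as a variable, code/swtest.py): 0 failures on 122 277 configurations with `g < 1` (heavy pairs: `t = 0`,
`slice_heavyPair_decAtT`; shallow lows: `t = 0` in all but 17 cases; deep light straddlers: `t > 0` needed in ≈ 80 %).  With `sliceMidLemmaW_of_lawSW`
and `sliceSingleLayer_of_midLemmas` this is the LAST open input of `SliceSingleLayer`. [this work] [status: open] -/
@[conjecture] def SliceLawSW : Prop :=
  ∀ (x g T : ℝ) (M a j' l h h' : ℕ), 0 < x → x < 1 → x ≤ g → g < 1 → 1 ≤ a →
    l + a ≤ j' → 2 * (l : ℝ) < T → j' < h + a → h ≤ h' → h' ≤ j' → h' ≤ M → T ≤ 2 * (h : ℝ) → T < (l : ℝ) + h →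
    ∃ t : ℝ, 0 ≤ t ∧ t * (1 - g) ≤ pairGate x T l h * g ∧
      DECAtT x (T + (a : ℝ) * g) j' (M + a) (swLaw (pairGate x T l h) g t l h h' a)

/-- the pullback of a certificate against the transferred law: `Σ_p e(p)·swLaw(p) = (1−γ)Φ(l) + γΦ(h) + t(1−g)(e(h′) − e(h+a))`. [this work] -/
theorem sum_coef_swLaw (e : ℕ → ℝ) (N : ℕ) (γ g t : ℝ) (l h h' a : ℕ) (hl : l + a ≤ N) (hh : h + a ≤ N) (hh' : h' ≤ N) :
    ∑ p ∈ Finset.range (N + 1), e p * swLaw γ g t l h h' a p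
      = (1 - γ) * ((1 - g) * e l + g * e (l + a)) + γ * ((1 - g) * e h + g * e (h + a))
        + t * (1 - g) * (e h' - e (h + a)) := by
  have ex : ∀ p ∈ Finset.range (N + 1), e p * swLaw γ g t l h h' a p
      = (1 - γ) * (1 - g) * (e p * (if p = l then (1 : ℝ) else 0)) + (1 - γ) * g * (e p * (if p = l + a then (1 : ℝ) else 0))
        + γ * (1 - g) * (e p * (if p = h then (1 : ℝ) else 0)) + t * (1 - g) * (e p * (if p = h' then (1 : ℝ) else 0))
        + (γ * g - t * (1 - g)) * (e p * (if p = h + a then (1 : ℝ) else 0)) := by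
    intro p _; simp only [swLaw]; ring
  rw [Finset.sum_congr rfl ex]
  simp only [Finset.sum_add_distrib, ← Finset.mul_sum]
  rw [sum_mul_indicator e N l (by omega), sum_mul_indicator e N (l + a) hl, sum_mul_indicator e N h (by omega),
    sum_mul_indicator e N h' hh', sum_mul_indicator e N (h + a) hh]
  ring

/-- **SW ⟹ LEMMA W.**  Weak duality of the certificate against the DEC transferred law gives
`(1−γ)Φ(l) + γΦ(h) + t(1−g)(e(h′) − e(h+a)) ≤ 0`; cheapness of `h′` relative to the cheapest giant `q₀` (and `β(h+a) ≥ β q₀`) gives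
`e(h′) − e(h+a) > 0`, so `(1−γ)Φ(l) + γΦ(h) ≤ 0`, which is the mid condition.  (`g = 1` makes cheapness impossible.) [this work] -/
theorem sliceMidLemmaW_of_lawSW (hSW : SliceLawSW) : SliceMidLemmaW := by
  intro x g T M a j' α β hx0 hx1 hxg hg1 ha hjM hβ hαβ q₀ hq1 hqM hq₀ h' hh'j hh'M hh'win hcheap l h J hla hlow hhh' hwin hT2 hcomp hhJ
  have hlh' : (l : ℝ) < h := by linarith
  have hlh : l < h := by exact_mod_cast hlh'
  set T' : ℝ := T + (a : ℝ) * g with hT'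
  set e : ℕ → ℝ := coefAt T' j' α β with he
  -- the row-1 copies of h, h′ are giants
  have eha : e (h + a) = -β (h + a) := by
    simp only [he, coefAt]; rw [if_neg (fun hc => by omega)]
  have eh'a : e (h' + a) = -β (h' + a) := by
    simp only [he, coefAt]; rw [if_neg (fun hc => by omega)]
  have hΦh' : slicePullback T' g j' a α β h' = (1 - g) * e h' + g * e (h' + a) := rfl
  rcases hg1.lt_or_eq with hg1' | hg1'
  · obtain ⟨t, ht0, ht1, hdec⟩ := hSW x g T M a j' l h h' hx0 hx1 hxg hg1' ha hla hlow hwin hhh' hh'j hh'M hT2 hcomp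
    have wd := dual_le_of_decAtT x T' j' (M + a) (swLaw (pairGate x T l h) g t l h h' a) hx0 hx1 hdec α β hβ hαβ
    have e1 := dual_functional_eq T' j' (M + a) α β (swLaw (pairGate x T l h) g t l h h' a) hjM.le
    rw [sum_coef_swLaw e (M + a) (pairGate x T l h) g t l h h' a (by omega) (by omega) (by omega)] at e1
    set γ : ℝ := pairGate x T l h with hγ
    have hγ1 : γ < 1 := pairGate_lt_one x T l h hx0 hx1 hlow hcomp
    -- cheapness: e h′ − e (h+a) > 0
    have hpos : 0 < e h' - e (h + a) := by
      rw [eha]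
      have h1 := hq₀ (h + a) (by omega) (by omega)
      have h2 := hq₀ (h' + a) (by omega) (by omega)
      rw [hΦh', eh'a] at hcheap
      nlinarith
    have hextra : 0 ≤ t * (1 - g) * (e h' - e (h + a)) := mul_nonneg (mul_nonneg ht0 (by linarith)) hpos.le
    have hineq : (1 - γ) * slicePullback T' g j' a α β l + γ * slicePullback T' g j' a α β h ≤ 0 := by
      have : (1 - γ) * ((1 - g) * e l + g * e (l + a)) + γ * ((1 - g) * e h + g * e (h + a)) ≤ 0 := by linarith
      simpa only [slicePullback, he] using this
    have hu : usage x T J l h = γ / (1 - γ) := by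
      have hnj : ¬ (J + 1 ≤ h) := by omega
      simp only [usage, gateOf, if_neg hnj, hγ]
    rw [hu]
    have h1γ : 0 < 1 - γ := by linarith
    rw [div_mul_eq_mul_div, le_div_iff₀ h1γ]
    nlinarith
  · -- g = 1: no window atom is cheap
    exfalso
    have h2 := hq₀ (h' + a) (by omega) (by omega)
    rw [hΦh', eh'a, hg1'] at hcheap
    linarith

/-- **`SliceLawSW → SliceSingleLayer`** (LEMMA D is a theorem; LEMMA W follows from SW). [this work] -/
theorem sliceSingleLayer_of_lawSW (hSW : SliceLawSW) : SliceSingleLayer :=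
  sliceSingleLayer_of_midLemmas sliceMidLemmaD_holds (sliceMidLemmaW_of_lawSW hSW)

/-- **`SliceLawSW → SliceClosedAll`** and **`→ SliceClosedWindowT`**: the whole slice-closure programme of the T-DEC law level now rests on the
single law-level conjecture `SliceLawSW`. [this work] -/
theorem sliceClosedAll_of_lawSW (hSW : SliceLawSW) : SliceClosedAll :=
  sliceClosedAll_of_singleLayer (sliceSingleLayer_of_lawSW hSW)

/-- **`SliceLawSW → SliceClosedWindowT`** (the window form of record, lead g22 p301931). [this work] -/
theorem sliceClosedWindowT_of_lawSW (hSW : SliceLawSW) : SliceClosedWindowT :=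
  sliceClosedWindowT_of_singleLayer (sliceSingleLayer_of_lawSW hSW)

end LawDec

end Quant

end Summit.CriticalPhenomena.PercolationContinuityZ3.Theorems
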